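import Mathlib
import HarnessLib

/-!
# From smooth to continuous test functions in an integral representation
(crux `BoundaryClosureR`, stmt-CriticalPhenomena-14004, line `pick-half-plane`, stub `stub_pickEngine`;
pure analysis helper for the engine input (S1))

If a functional `L` on `C(ℂ, ℂ)` is additive and homogeneous on test functions supported in a
compact `K`, satisfies `‖L ψ‖ ≤ C · M` whenever `tsupport ψ ⊆ K` and `‖ψ‖ ≤ M` pointwise, and is
represented as `L φ = ∫ φ g` on SMOOTH compactly supported `φ` with `tsupport φ ⊆ V` (`V` open,
`V ⊆ K`, `g` continuous on `K`), then the same representation holds for every CONTINUOUS `ψ` with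
compact `tsupport ψ ⊆ V` (`integral_rep_of_smooth_rep`).  Proof: mollify — Mathlib's
`Continuous.exists_contDiff_dist_le_of_forall_mem_ball_dist_le` gives smooth `φ` with
`‖φ − ψ‖_∞ ≤ η` and (taking the tolerance `0` off the `ε`-thickening of `tsupport ψ`)
`tsupport φ ⊆ cthickening ε (tsupport ψ) ⊆ V`; both sides of the representation move by `O(η)`.
-/

noncomputable section

open scoped Topology ContDiff
open Filter Set Metric MeasureTheory

namespace Summit.CriticalPhenomena.SAWScalingLimit.Theorems.PickHalfPlane.LocalL1

/-- A continuous function supported in an open set `V`, times a function continuous on a superset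
`K ⊇ V`, is continuous on `ℂ` (it vanishes on the open complement of the support). [folklore] -/
theorem continuous_mul_of_tsupport_subset {ψ g : ℂ → ℂ} {V K : Set ℂ} (hV : IsOpen V) (hVK : V ⊆ K)
    (hψ : Continuous ψ) (hψV : tsupport ψ ⊆ V) (hg : ContinuousOn g K) :
    Continuous fun z => ψ z * g z := by
  rw [continuous_iff_continuousAt]
  intro z
  by_cases hz : z ∈ V
  · have hgz : ContinuousAt g z :=
      (hg.mono hVK).continuousAt (hV.mem_nhds hz)
    exact hψ.continuousAt.mul hgz
  · -- `z ∉ V ⊇ tsupport ψ`: the product vanishes near `z`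
    have hz' : z ∉ tsupport ψ := fun h => hz (hψV h)
    have hev : (fun w => ψ w * g w) =ᶠ[𝓝 z] fun _ => 0 := by
      have hopen : IsOpen (tsupport ψ)ᶜ := (isClosed_tsupport ψ).isOpen_compl
      filter_upwards [hopen.mem_nhds hz'] with w hw
      rw [image_eq_zero_of_notMem_tsupport hw, zero_mul]
    have h0 : ψ z * g z = 0 := by rw [image_eq_zero_of_notMem_tsupport hz', zero_mul]
    rw [ContinuousAt, h0]
    exact (tendsto_congr' hev).2 tendsto_const_nhds

/-- **Smooth approximation with support control.** A continuous compactly supported `ψ` with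
`tsupport ψ ⊆ V` (`V` open) is, for every `η > 0`, uniformly `η`-close to a smooth compactly
supported `φ` with `tsupport φ ⊆ V`. [folklore] -/
theorem exists_smooth_near {ψ : ℂ → ℂ} {V : Set ℂ} (hV : IsOpen V) (hψ : Continuous ψ)
    (hψc : HasCompactSupport ψ) (hψV : tsupport ψ ⊆ V) {η : ℝ} (hη : 0 < η) :
    ∃ φ : ℂ → ℂ, ContDiff ℝ ∞ φ ∧ HasCompactSupport φ ∧ tsupport φ ⊆ V ∧ ∀ z, ‖φ z - ψ z‖ ≤ η := by
  -- room around the support inside `V`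
  obtain ⟨ε₀, hε₀, hε₀V⟩ := hψc.isCompact.exists_cthickening_subset_open hV hψV
  -- uniform continuity
  have huc : UniformContinuous ψ := hψc.uniformContinuous_of_continuous hψ
  obtain ⟨ε₁, hε₁, hε₁ψ⟩ := Metric.uniformContinuous_iff.1 huc η hη
  set ε : ℝ := min ε₀ ε₁ with hεdef
  have hε : 0 < ε := lt_min hε₀ hε₁
  obtain ⟨φ, hφ, hφψ⟩ := hψ.exists_contDiff_dist_le_of_forall_mem_ball_dist_le hε
  -- uniform closeness
  have hclose : ∀ z, ‖φ z - ψ z‖ ≤ η := by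
    intro z
    rw [← dist_eq_norm]
    refine hφψ z η fun w hw => (hε₁ψ ?_).le
    exact lt_of_lt_of_le (mem_ball.1 hw) (min_le_right _ _)
  -- support control: off the `ε`-thickening of `tsupport ψ`, `φ = 0`
  have hsupp : Function.support φ ⊆ Metric.thickening ε (tsupport ψ) := by
    intro z hz
    by_contra hzt
    have hzero : ∀ w ∈ ball z ε, ψ w = 0 := by
      intro w hw
      refine image_eq_zero_of_notMem_tsupport fun hwt => hzt ?_
      exact Metric.mem_thickening_iff.2 ⟨w, hwt, by rw [dist_comm]; exact mem_ball.1 hw⟩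
    have hz0 : ψ z = 0 := hzero z (mem_ball_self hε)
    have h := hφψ z 0 fun w hw => by rw [hzero w hw, hz0, dist_self]
    rw [hz0, dist_le_zero] at h
    exact hz h
  have htsupp : tsupport φ ⊆ Metric.cthickening ε₀ (tsupport ψ) :=
    (closure_mono hsupp).trans ((Metric.closure_thickening_subset_cthickening _ _).trans
      (Metric.cthickening_mono (min_le_left _ _) _))
  refine ⟨φ, hφ, ?_, htsupp.trans hε₀V, hclose⟩
  exact IsCompact.of_isClosed_subset hψc.isCompact.cthickening (isClosed_tsupport φ) htsupp

/-- **Integral representation: from smooth to continuous tests.**  `L` additive/homogeneous on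
tests supported in the compact `K`, `‖L ψ‖ ≤ C · sup ‖ψ‖` there, `g` continuous on `K`, `V ⊆ K`
open, and `L φ = ∫ φ g` for smooth compactly supported `φ` in `V`: then `L ψ = ∫ ψ g` for every
continuous compactly supported `ψ` with `tsupport ψ ⊆ V`. [folklore] -/
theorem integral_rep_of_smooth_rep {L : C(ℂ, ℂ) → ℂ} {V K : Set ℂ} (hV : IsOpen V)
    (hK : IsCompact K) (hVK : V ⊆ K)
    (hadd : ∀ ψ₁ ψ₂ : C(ℂ, ℂ), HasCompactSupport ψ₁ → tsupport ψ₁ ⊆ K → HasCompactSupport ψ₂ →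
      tsupport ψ₂ ⊆ K → L (ψ₁ + ψ₂) = L ψ₁ + L ψ₂)
    (hsmul : ∀ (c : ℂ) (ψ : C(ℂ, ℂ)), HasCompactSupport ψ → tsupport ψ ⊆ K → L (c • ψ) = c * L ψ)
    {C : ℝ} (hbd : ∀ ψ : C(ℂ, ℂ), tsupport ψ ⊆ K → ∀ M : ℝ, (∀ z, ‖ψ z‖ ≤ M) → ‖L ψ‖ ≤ C * M)
    {g : ℂ → ℂ} (hg : ContinuousOn g K)
    (hrep : ∀ φ : ℂ → ℂ, ContDiff ℝ ∞ φ → HasCompactSupport φ → tsupport φ ⊆ V →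
      ∀ Φ : C(ℂ, ℂ), (⇑Φ = φ) → L Φ = ∫ z, φ z * g z)
    (ψ : C(ℂ, ℂ)) (hψc : HasCompactSupport ψ) (hψV : tsupport ψ ⊆ V) :
    L ψ = ∫ z, ψ z * g z := by
  -- the integral of `‖g‖` over `K`
  have hgK : IntegrableOn g K := hg.integrableOn_compact hK
  set I : ℝ := ∫ z in K, ‖g z‖ with hI
  have hI0 : 0 ≤ I := integral_nonneg fun z => norm_nonneg _
  -- it suffices to bound the difference by `(max C 0 + I) · η` for every `η > 0`
  suffices h : ∀ η : ℝ, 0 < η → ‖L ψ - ∫ z, ψ z * g z‖ ≤ (max C 0 + I) * η by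
    by_contra hne
    have hpos : 0 < ‖L ψ - ∫ z, ψ z * g z‖ := norm_pos_iff.2 (sub_ne_zero.2 hne)
    have hM : 0 < max C 0 + I + 1 := by positivity
    have := h (‖L ψ - ∫ z, ψ z * g z‖ / (2 * (max C 0 + I + 1))) (by positivity)
    have h2 : (max C 0 + I) * (‖L ψ - ∫ z, ψ z * g z‖ / (2 * (max C 0 + I + 1))) <
        ‖L ψ - ∫ z, ψ z * g z‖ := by
      rw [mul_div_assoc', div_lt_iff₀ (by positivity)]
      nlinarith [le_max_right C 0]
    linarith
  intro η hη
  obtain ⟨φ, hφ, hφc, hφV, hφψ⟩ := exists_smooth_near hV ψ.continuous hψc hψV hη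
  -- the smooth test as an element of `C(ℂ, ℂ)`
  set Φ : C(ℂ, ℂ) := ⟨φ, hφ.continuous⟩ with hΦ
  have hΦK : tsupport (Φ : ℂ → ℂ) ⊆ K := hφV.trans hVK
  have hψK : tsupport (ψ : ℂ → ℂ) ⊆ K := hψV.trans hVK
  have hΦc : HasCompactSupport (Φ : ℂ → ℂ) := hφc
  -- `L` on the difference
  have hdiff : L ψ - L Φ = L (ψ - Φ) := by
    have hneg : L ((-1 : ℂ) • Φ) = (-1) * L Φ := hsmul (-1) Φ hΦc hΦK
    have hnegc : HasCompactSupport ((((-1 : ℂ) • Φ : C(ℂ, ℂ))) : ℂ → ℂ) := hΦc.smul_left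
    have hnegK : tsupport ((((-1 : ℂ) • Φ : C(ℂ, ℂ))) : ℂ → ℂ) ⊆ K :=
      (tsupport_smul_subset_right (fun _ : ℂ => (-1 : ℂ)) (Φ : ℂ → ℂ)).trans hΦK
    have hsum := hadd ψ ((-1 : ℂ) • Φ) hψc hψK hnegc hnegK
    have heq : ψ + (-1 : ℂ) • Φ = ψ - Φ := by ext z; simp [sub_eq_add_neg]
    rw [heq] at hsum
    rw [hsum, hneg]; ring
  have hLbound : ‖L (ψ - Φ)‖ ≤ max C 0 * η := by
    have hK' : tsupport (((ψ - Φ : C(ℂ, ℂ))) : ℂ → ℂ) ⊆ K := by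
      refine (closure_mono (Function.support_sub _ _)).trans ?_
      rw [closure_union]
      exact union_subset hψK hΦK
    refine (hbd _ hK' η fun z => ?_).trans (mul_le_mul_of_nonneg_right (le_max_left _ _) hη.le)
    rw [ContinuousMap.sub_apply, norm_sub_rev]
    exact hφψ z
  -- the integral on the difference
  have hcontψ : Continuous fun z => ψ z * g z :=
    continuous_mul_of_tsupport_subset hV hVK ψ.continuous hψV hg
  have hcontφ : Continuous fun z => φ z * g z :=
    continuous_mul_of_tsupport_subset hV hVK hφ.continuous hφV hg
  have hintψ : Integrable fun z => ψ z * g z :=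
    hcontψ.integrable_of_hasCompactSupport hψc.mul_right
  have hintφ : Integrable fun z => φ z * g z :=
    hcontφ.integrable_of_hasCompactSupport hφc.mul_right
  have hIbound : ‖(∫ z, φ z * g z) - ∫ z, ψ z * g z‖ ≤ I * η := by
    rw [← integral_sub hintφ hintψ]
    have hpt : ∀ z, ‖φ z * g z - ψ z * g z‖ ≤ K.indicator (fun z => η * ‖g z‖) z := by
      intro z
      by_cases hz : z ∈ K
      · rw [indicator_of_mem hz, ← sub_mul, norm_mul]
        exact mul_le_mul_of_nonneg_right (hφψ z) (norm_nonneg _)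
      · have hzψ : ψ z = 0 := image_eq_zero_of_notMem_tsupport fun h => hz (hψK h)
        have hzφ : φ z = 0 := image_eq_zero_of_notMem_tsupport fun h => hz (hΦK h)
        rw [indicator_of_notMem hz, hzψ, hzφ]; simp
    calc ‖∫ z, (φ z * g z - ψ z * g z)‖ ≤ ∫ z, ‖φ z * g z - ψ z * g z‖ :=
          norm_integral_le_integral_norm _
      _ ≤ ∫ z, K.indicator (fun z => η * ‖g z‖) z := by
          have hint : IntegrableOn (fun z => η * ‖g z‖) K := hgK.norm.const_mul η
          exact integral_mono_of_nonneg (Eventually.of_forall fun z => norm_nonneg _)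
            (hint.integrable_indicator hK.measurableSet) (Eventually.of_forall hpt)
      _ = I * η := by
          rw [integral_indicator hK.measurableSet, integral_const_mul, hI, mul_comm]
  -- combine
  have hrepΦ : L Φ = ∫ z, φ z * g z := hrep φ hφ hφc hφV Φ rfl
  calc ‖L ψ - ∫ z, ψ z * g z‖
      = ‖L (ψ - Φ) + ((∫ z, φ z * g z) - ∫ z, ψ z * g z)‖ := by
        rw [← hdiff, hrepΦ]; ring_nf
    _ ≤ ‖L (ψ - Φ)‖ + ‖(∫ z, φ z * g z) - ∫ z, ψ z * g z‖ := norm_add_le _ _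
    _ ≤ max C 0 * η + I * η := add_le_add hLbound hIbound
    _ = (max C 0 + I) * η := by ring

/-- **Registered sub-goal `pickEngine_repContinuous`** (crux item stmt-CriticalPhenomena-14004, line
`pick-half-plane`, stub `stub_pickEngine`, engine input (S1)): the passage from smooth to continuous
test functions in an integral representation of a bounded functional, in registry form (one
`∀`-term; see `integral_rep_of_smooth_rep`). [folklore] -/
theorem pickEngine_repContinuous : ∀ (L : C(ℂ, ℂ) → ℂ) (V K : Set ℂ), IsOpen V → IsCompact K → V ⊆ K → (∀ ψ₁ ψ₂ : C(ℂ, ℂ), HasCompactSupport ψ₁ → tsupport ψ₁ ⊆ K → HasCompactSupport ψ₂ → tsupport ψ₂ ⊆ K → L (ψ₁ + ψ₂) = L ψ₁ + L ψ₂) → (∀ (c : ℂ) (ψ : C(ℂ, ℂ)), HasCompactSupport ψ → tsupport ψ ⊆ K → L (c • ψ) = c * L ψ) → ∀ (C : ℝ), (∀ ψ : C(ℂ, ℂ), tsupport ψ ⊆ K → ∀ M : ℝ, (∀ z, ‖ψ z‖ ≤ M) → ‖L ψ‖ ≤ C * M) → ∀ (g : ℂ → ℂ), ContinuousOn g K →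 (∀ φ : ℂ → ℂ, ContDiff ℝ ∞ φ → HasCompactSupport φ → tsupport φ ⊆ V → ∀ Φ : C(ℂ, ℂ), (⇑Φ = φ) → L Φ = ∫ z, φ z * g z) → ∀ ψ : C(ℂ, ℂ), HasCompactSupport ψ → tsupport ψ ⊆ V → L ψ = ∫ z, ψ z * g z :=
  fun _ _ _ hV hK hVK hadd hsmul _ hbd _ hg hrep ψ hψc hψV =>
    integral_rep_of_smooth_rep hV hK hVK hadd hsmul hbd hg hrep ψ hψc hψV

end Summit.CriticalPhenomena.SAWScalingLimit.Theorems.PickHalfPlane.LocalL1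

end
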